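import Summits.BirchSwinnertonDyer.BirchSwinnertonDyer.Theorems.SemiOrdinaryEisensteinDescentWildSplitEisensteinValueAtOneVTwoWitnessOwnPointDoor
import Summits.BirchSwinnertonDyer.BirchSwinnertonDyer.Theorems.SemiOrdinaryEisensteinDescentWildSplitEisensteinValueAtOneVAdditiveOwnPointAtThree
import Summits.BirchSwinnertonDyer.Rank1Residual.Visibility.TwoWitnessLowerHalf352944s1
import Summits.BirchSwinnertonDyer.Rank1Residual.GaloisImage.ThreeCongruenceHesseCertificateLemmas
import Literature.NumberTheory.EllipticCurves.Fisher2012.HesseFamilyThreeReverseProofs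
import HarnessLib

/-!
# Route `SemiOrdinaryEisensteinDescent`, crux #2″ `WildSplitEisensteinValueAtOneV` (E_𝟙^V, stmt-BirchSwinnertonDyer-26610):
# the content row `352944s1` CASSELS–TATE-FREE — `ord₃ #Ш(E)_an ≤ ord₃ #Ш(E)` from `(ℤ/3)² ↪ Ш(E)` with GZK as the ONLY
# named fact (cell `pub/bsd-wall`, width seat `bsd-wall-soed-p1-w3` g23; `--supports stmt-BirchSwinnertonDyer-26610`; THEOREMS
# ONLY; Theses-free)

WHY. Modulo print and the leaf Z, crux #2″ is «`Typed.MissingLowerBoundAt W 3` for every cell curve» (w3 g14); the nine in-range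
content rows were kernel theorems modulo EXACTLY {Cassels–Tate `hCT`, GZK `hGZK`} + Cremona's analytic data (w3 g20–g22,
`…VisibleNineThetaFree`). This file removes `hCT` at the row `E = 352944s1` (`#Ш_an = 9`, type IV at `3` with `c₃ = 1`):

* the partner `F = 117648bh1` (rank 3) and b2b's kernel record `Visibility.TwoWitnessLowerHalf352944s1` (cell `b2b-bsdres`, x11c /
  bsd-addord k1-c3 — CREDITED, reused verbatim): witnesses `T₁ = (2023/81, 2386/729)`, `T₂ = (-28329497/1347921, 446083393454/1564936281)`,
  both in the formal group of `F` at `3` at level `≥ 2` (option (a) at `3`), independent mod `3F(ℚ)` (four reduction certificates),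
  kind (i) at `2, 19, 43`, `E[3]` irreducible;
* NEW: the OWN POINT `G₀ = (-49, 2) ∈ E(ℚ)` is NOT `3`-divisible in `E(ℚ₃)` — Tate normal form `J = [0, 3, 0, -7200, -242496]`
  (translate `x ↦ x + 1`) of type IV with Step-5 quadratic `Y² + 1` rootless mod `3` ⟹ `c₃ = 1`, `E(ℚ₃) = E₀(ℚ₃)`, `3·E(ℚ₃) ⊆ E₁(ℚ₃)`,
  while `G₀ ↦ (-50, 2)` is integral (`AdditiveOwnPointAtThree.not_exists_three_nsmul_eq_baseChange_of_normalForm`);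
* the door `VisibleTwoWitnessOwnPoint.missingLowerBoundAt_rankOne_irr_of_two_witnesses_of_ownPoint_of_places`: `(ℤ/3)² ↪ Ш(E)`,
  `9 ∣ #Ш(E)`, hence `ord₃ #Ш_an ≤ 2 ≤ ord₃ #Ш` — NO Cassels–Tate;
* θ-free form via the DIRECT Hesse pencil `X_E(3)` at `(l : m) = (-612 : 1)`, `u = 48` (Fisher 2012 Thm. 13.2; w3 g21's certificate).

RESULT: `missingLowerBound_352944s1_ctFree (hGZK) … : MissingLowerBoundAt W 3` — named fact GZK ONLY (rank `1`, `Ш` finite) + the data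
`r_an(E) = 1`, `ord₃ #Ш(E)_an ≤ 2`. HONEST FRAMING: per pair; NOT a class theorem; BSD₃(E) is NOT claimed (the upper half is the
Kolyvagin column's); crux #2″ stays research-open class-wide; nothing booked. BSD is not proved by any of this.

References: [CremonaMazur2000] §3; [AgasheStein2002] Lemma 3.6; [SilvermanATAEC1994] IV.9.4 Step 5; [SilvermanAEC2009] VII.2.1,
IV.6.4; [Fisher2012Hessian] Thm. 13.2; [Cremona2006] (352944s1, 117648bh1).
-/

set_option autoImplicit false
set_option linter.dupNamespace false -- the Theorems namespace repeats the summit name by design (D-0017 nested layout)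

noncomputable section

open scoped Classical

open WeierstrassCurve IsLocalRing Literature.NumberTheory.EllipticCurves
  Literature.NumberTheory.EllipticCurves.Rank1Residual
  Literature.NumberTheory.EllipticCurves.Rank1Residual.Typed
  Literature.NumberTheory.EllipticCurves.Rank1Residual.X11RankOneCertificates
  Literature.NumberTheory.GaloisRepresentations
  Summit.BirchSwinnertonDyer.Rank1Residual.X11b
  Summit.BirchSwinnertonDyer.Rank1Residual.GaloisImage
  Summit.BirchSwinnertonDyer.Rank1Residual.Supersingular
  Summit.BirchSwinnertonDyer.Rank1Residual.Visibility
open NumberField IsDedekindDomain Rat.HeightOneSpectrum Field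
open Summit.BirchSwinnertonDyer.BirchSwinnertonDyer.Theorems.AdditiveBranchIMCGordTwoRankOneVisibility

namespace Summit.BirchSwinnertonDyer.BirchSwinnertonDyer.Theorems.Visible352944s1CTFree

/-! ## §1 The own point at `3`: `G₀ = (-49, 2) ∉ 3·E(ℚ₃)` (type IV, `c₃ = 1`) -/

/-- **The Tate normal form at `3`**: translating `x ↦ x + 1` carries `E = [0,0,0,-7203,-235294]` to `J = [0,3,0,-7200,-242496]` over
`ℚ₃` (`J` read with `ℤ₃`-coefficients). [cite: SilvermanATAEC1994, IV.9.4 Steps 1–2 (PDF p. 344)] -/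
theorem normalForm_eq :
    (⟨1, 1, 0, 0⟩ : VariableChange ℚ_[3]) • (⟨0, 0, 0, -7203, -235294⟩ : WeierstrassCurve ℚ).baseChange ℚ_[3] =
      (⟨0, 3, 0, -7200, -242496⟩ : WeierstrassCurve ℤ_[3]).baseChange ℚ_[3] := by
  ext <;> simp [WeierstrassCurve.baseChange, WeierstrassCurve.map, WeierstrassCurve.variableChange_a₁,
    WeierstrassCurve.variableChange_a₂, WeierstrassCurve.variableChange_a₃, WeierstrassCurve.variableChange_a₄,
    WeierstrassCurve.variableChange_a₆] <;> norm_num <;> norm_cast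

/-- `Δ(J) = 813182976 = 2¹²·3⁵·19·43 ≡ 0 (mod 3)`: the reduction is singular. [folklore] -/
theorem residue_Δ_normalForm : residue ℤ_[3] (⟨0, 3, 0, -7200, -242496⟩ : WeierstrassCurve ℤ_[3]).Δ = 0 := by
  refine (residue_eq_zero_iff _).mpr (AdditiveOwnPointAtThree.mem_maximalIdeal_of_three_dvd ⟨271060992, ?_⟩)
  norm_num [WeierstrassCurve.Δ, WeierstrassCurve.b₂, WeierstrassCurve.b₄, WeierstrassCurve.b₆, WeierstrassCurve.b₈]

/-- `c₄(J) = 345744 = 3·115248 ≡ 0 (mod 3)`: the reduction is a CUSP (additive). [folklore] -/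
theorem residue_c₄_normalForm : residue ℤ_[3] (⟨0, 3, 0, -7200, -242496⟩ : WeierstrassCurve ℤ_[3]).c₄ = 0 := by
  refine (residue_eq_zero_iff _).mpr (AdditiveOwnPointAtThree.mem_maximalIdeal_of_three_dvd ⟨115248, ?_⟩)
  norm_num [WeierstrassCurve.c₄, WeierstrassCurve.b₂, WeierstrassCurve.b₄]

/-- **`c₃ = 1`: every `ℚ₃`-point of `J` has nonsingular reduction** — type IV normal form (`a₃ = 3·0`, `a₄ = 9·(-800)`,
`a₆ = 9·(-26944)`) with Step-5 quadratic `Y² − (-26944) ≡ Y² + 1` rootless mod `3` (`decide`).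
[cite: SilvermanATAEC1994, IV.9.4 Step 5 (PDF p. 344)] -/
theorem top_normalForm :
    (⟨0, 3, 0, -7200, -242496⟩ : WeierstrassCurve ℤ_[3]).nonsingularReductionSubgroup (integers_valuationRing_valuation ℤ_[3] ℚ_[3]) = ⊤ :=
  AdditiveOwnPointAtThree.nonsingularReductionSubgroup_eq_top_of_normalForm_IV _ ⟨0, by norm_num⟩ ⟨1, by norm_num⟩ 0 (-26944)
    (by norm_num) ⟨-800, by norm_num⟩ (by norm_num) (by decide)

/-- **The own point is not locally `3`-divisible at `3`**: for `W = 352944s1` and the place `v ∣ 3`, `G₀ = (-49, 2) ∉ 3·W(ℚ_v)` — its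
image `(-50, 2)` on `J` is integral, `J` is a cusp with `E = E₀`, so `3·E(ℚ₃) ⊆ E₁(ℚ₃) ∌ (-50, 2)`.
[cite: SilvermanAEC2009, VII.2 Prop. 2.1] [cite: SilvermanATAEC1994, IV.9.4 Step 5] -/
theorem not_exists_three_nsmul_eq_G₀ {v : HeightOneSpectrum (𝓞 ℚ)} (hv : (primesEquiv v : ℕ) = 3)
    (hG : (⟨0, 0, 0, -7203, -235294⟩ : WeierstrassCurve ℚ).toAffine.Nonsingular (-49) 2) :
    ¬ ∃ Q : ((⟨0, 0, 0, -7203, -235294⟩ : WeierstrassCurve ℚ).baseChange (v.adicCompletion ℚ)).toAffine.Point,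
      3 • Q = WeierstrassCurve.Affine.Point.baseChange (W' := (⟨0, 0, 0, -7203, -235294⟩ : WeierstrassCurve ℚ)) ℚ
        (v.adicCompletion ℚ) (.some _ _ hG) :=
  AdditiveOwnPointAtThree.not_exists_three_nsmul_eq_baseChange_of_normalForm _ _ residue_Δ_normalForm residue_c₄_normalForm
    top_normalForm _ normalForm_eq _
    (AdditiveOwnPointAtThree.not_reducesToZero_congr_pointEquiv_some _ _ _ normalForm_eq hG
      ⟨-50, by simp [VariableChange.toX_def]; norm_cast⟩) hv

/-! ## §2 The row, Cassels–Tate-free -/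

/-- **`ord₃ #Ш(E)_an ≤ ord₃ #Ш(E)` for `E = 352944s1`, CASSELS–TATE-FREE kernel record.** Named fact: GZK ONLY (`hGZK`); displayed
per-pair binders: `θ : F[3] ⥲ E[3]` (`F = 117648bh1`), Cremona's `r_an = 1` (`hr1`) and `ord₃ #Ш_an ≤ 2` (`hq`, `hv`); EVERYTHING ELSE
IN THE KERNEL: b2b's two witnesses with their local options (formal group at `3`, kind (i) at `2, 19, 43`), independence mod `3F(ℚ)`,
`E[3]` irreducible, good reduction off `S` (all from `Visibility.TwoWitnessLowerHalf352944s1`, reused), and the NEW own point at `3` (§1).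
Door `VisibleTwoWitnessOwnPoint.missingLowerBoundAt_rankOne_irr_of_two_witnesses_of_ownPoint_of_places` (`(ℤ/3)² ↪ Ш(E)`, no squareness).
Per pair; NOT a class theorem; nothing booked. [cite: CremonaMazur2000, §3 and Table 1] [cite: AgasheStein2002, Lemma 3.6]
[cite: SilvermanAEC2009, Thm. IV.6.4, Prop. VII.2.1] [cite: SilvermanATAEC1994, IV.9.4 Step 5] [cite: Cremona2006, Table 1 (Cremona labels 352944s1, 117648bh1)] -/
theorem missingLowerBound_352944s1_ctFree_of_congr (hGZK : rank_eq_analyticRank_of_analyticRank_le_one)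
    {W F : WeierstrassCurve ℚ} [W.IsElliptic] [W.IsGloballyMinimal] [F.IsElliptic] [F.IsGloballyMinimal]
    (hWeq : W = ⟨0, 0, 0, -7203, -235294⟩) (hFeq : F = ⟨0, 0, 0, -2307, 42050⟩)
    (hr1 : W.analyticRank = 1) {q : ℚ} (hq : shaAn W = (q : ℂ)) (hv : padicValRat 3 q ≤ 2)
    (θ : geomTorsion F (3 : ℤ) ≃+ geomTorsion W (3 : ℤ))
    (hθ : ∀ (σ : Field.absoluteGaloisGroup ℚ) (P : geomTorsion F (3 : ℤ)), θ (σ • P) = σ • θ P) :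
    MissingLowerBoundAt W 3 := by
  haveI : Fact (Nat.Prime 3) := ⟨by norm_num⟩
  have hT1 : F.toAffine.Nonsingular ((2023 : ℚ) / 81) ((2386 : ℚ) / 729) := by
    rw [hFeq]
    haveI := isElliptic_c117648bh1
    exact WeierstrassCurve.Affine.equation_iff_nonsingular.mp ((WeierstrassCurve.Affine.equation_iff _ _).mpr (by norm_num))
  have hT2 : F.toAffine.Nonsingular ((-28329497 : ℚ) / 1347921) ((446083393454 : ℚ) / 1564936281) := by
    rw [hFeq]
    haveI := isElliptic_c117648bh1
    exact WeierstrassCurve.Affine.equation_iff_nonsingular.mp ((WeierstrassCurve.Affine.equation_iff _ _).mpr (by norm_num))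
  have hTd : F.toAffine.Nonsingular ((28314148066 : ℚ) / 801173025) ((-1547798958472886 : ℚ) / 22677202472625) := by
    rw [hFeq]
    haveI := isElliptic_c117648bh1
    exact WeierstrassCurve.Affine.equation_iff_nonsingular.mp ((WeierstrassCurve.Affine.equation_iff _ _).mpr (by norm_num))
  -- the own point of `E`
  have hG : W.toAffine.Nonsingular (-49) 2 := by
    rw [hWeq]
    haveI := isElliptic_c352944s1
    exact WeierstrassCurve.Affine.equation_iff_nonsingular.mp ((WeierstrassCurve.Affine.equation_iff _ _).mpr (by norm_num))
  -- sum and difference of the witnesses as explicit points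
  obtain ⟨hTs, es⟩ := sum_witnesses_c117648bh1 F hFeq hT1 hT2
  obtain ⟨hT1', ed⟩ := diff_witnesses_c117648bh1 F hFeq hTd hT2
  have ed' : (Affine.Point.some _ _ hT1 : F.toAffine.Point) - Affine.Point.some _ _ hT2 = Affine.Point.some _ _ hTd :=
    sub_eq_iff_eq_add.mpr ed.symm
  -- the four non-divisibilities and independence mod 3F(ℚ)
  have h1 := not_mem_range_zsmul_T1_c117648bh1 F hFeq hT1
  have h2 := not_mem_range_zsmul_T2_c117648bh1 F hFeq hT2
  have hs := not_mem_range_zsmul_T1pT2_c117648bh1 F hFeq hTs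
  have hd := not_mem_range_zsmul_T1mT2_c117648bh1 F hFeq hTd
  rw [← es] at hs
  rw [← ed'] at hd
  have hind := indep_mod_three_of_not_mem h1 h2 hs hd
  have hirr : Irr W 3 := by rw [hWeq]; exact irr_c352944s1_3
  -- kind (i) places: #F(ℚ_ℓ)[3] = 1 by the kernel decider
  have h2 : ∀ w : HeightOneSpectrum (𝓞 ℚ), (primesEquiv w : ℕ) = 2 →
      Nat.card (nsmulAddMonoidHom 3 : (F.baseChange (w.adicCompletion ℚ)).toAffine.Point →+ _).ker = 1 := by
    intro w hw
    haveI : Fact (Nat.Prime 2) := ⟨by norm_num⟩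
    exact (LocalTorsion3At.free_kind_i_of_checkAt 2 0 0 0 (-2307) 42050 (by norm_num) (by decide +kernel)
      (k := 3) (cert := []) (by decide +kernel) F (by rw [hFeq]; ext <;> norm_num) hw).2
  have h19 : ∀ w : HeightOneSpectrum (𝓞 ℚ), (primesEquiv w : ℕ) = 19 →
      Nat.card (nsmulAddMonoidHom 3 : (F.baseChange (w.adicCompletion ℚ)).toAffine.Point →+ _).ker = 1 := by
    intro w hw
    haveI : Fact (Nat.Prime 19) := ⟨by norm_num⟩
    exact (LocalTorsion3At.free_kind_i_of_checkAt 19 0 0 0 (-2307) 42050 (by norm_num) (by decide +kernel)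
      (k := 1) (cert := [((9 : ℤ), 0, 1, 0)]) (by decide +kernel) F (by rw [hFeq]; ext <;> norm_num) hw).2
  have h43 : ∀ w : HeightOneSpectrum (𝓞 ℚ), (primesEquiv w : ℕ) = 43 →
      Nat.card (nsmulAddMonoidHom 3 : (F.baseChange (w.adicCompletion ℚ)).toAffine.Point →+ _).ker = 1 := by
    intro w hw
    haveI : Fact (Nat.Prime 43) := ⟨by norm_num⟩
    exact (LocalTorsion3At.free_kind_i_of_checkAt 43 0 0 0 (-2307) 42050 (by norm_num) (by decide +kernel)
      (k := 1) (cert := [((16 : ℤ), 0, 1, 0)]) (by decide +kernel) F (by rw [hFeq]; ext <;> norm_num) hw).2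
  -- option (a) AT 3 for both witnesses: level-2 points of the formal group (3 ∣ den x, 9 ∣ num (x/y))
  have h3a : ∀ w : HeightOneSpectrum (𝓞 ℚ), (primesEquiv w : ℕ) = 3 →
      ∃ Q : (F.baseChange (w.adicCompletion ℚ)).toAffine.Point,
        3 • Q = WeierstrassCurve.Affine.Point.baseChange (W' := F) ℚ (w.adicCompletion ℚ) (.some _ _ hT1) := by
    intro w hw
    exact LocalDivisibility.exists_nsmul_eq_baseChange_of_dvd_den 0 0 0 (-2307) 42050 F
      (by rw [hFeq]; ext <;> norm_num) (p := 3) (ℓ := 3) (by norm_num) hw hT1 (by decide +kernel) (fun _ ↦ by decide +kernel)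
  have h3b : ∀ w : HeightOneSpectrum (𝓞 ℚ), (primesEquiv w : ℕ) = 3 →
      ∃ Q : (F.baseChange (w.adicCompletion ℚ)).toAffine.Point,
        3 • Q = WeierstrassCurve.Affine.Point.baseChange (W' := F) ℚ (w.adicCompletion ℚ) (.some _ _ hT2) := by
    intro w hw
    exact LocalDivisibility.exists_nsmul_eq_baseChange_of_dvd_den 0 0 0 (-2307) 42050 F
      (by rw [hFeq]; ext <;> norm_num) (p := 3) (ℓ := 3) (by norm_num) hw hT2 (by decide +kernel) (fun _ ↦ by decide +kernel)
  -- the prime list: every prime divisor of Δ_E, Δ_F lies in L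
  set L : List ℕ := [2, 3, 19, 43] with hL
  have hLp : ∀ r ∈ L, r.Prime := by
    intro r hr; simp only [hL, List.mem_cons, List.mem_nil_iff, or_false] at hr
    rcases hr with rfl | rfl | rfl | rfl <;> norm_num
  have hΔE : ∀ r : ℕ, r.Prime → (r : ℤ) ∣ (⟨0, 0, 0, -7203, -235294⟩ : WeierstrassCurve ℤ).Δ → r ∈ L :=
    forall_mem_of_natAbs_eq_prod_pow L [12, 5, 1, 1] hLp (by decide +kernel)
  have hΔF : ∀ r : ℕ, r.Prime → (r : ℤ) ∣ (⟨0, 0, 0, -2307, 42050⟩ : WeierstrassCurve ℤ).Δ → r ∈ L :=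
    forall_mem_of_natAbs_eq_prod_pow L [12, 8, 1, 1] hLp (by decide +kernel)
  -- the set of places S (over L)
  set e := primesEquiv (R := 𝓞 ℚ) with he
  set S : Finset (HeightOneSpectrum (𝓞 ℚ)) :=
    (L.filterMap fun r ↦ if h : r.Prime then some (e.symm ⟨r, h⟩) else none).toFinset with hSdef
  have hmemS : ∀ w : HeightOneSpectrum (𝓞 ℚ), w ∈ S ↔ (e w : ℕ) ∈ L := by
    intro w
    rw [hSdef, List.mem_toFinset, List.mem_filterMap]
    constructor
    · rintro ⟨r, hr, hrw⟩
      by_cases hrp : r.Prime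
      · rw [dif_pos hrp, Option.some.injEq] at hrw
        rw [← hrw, Equiv.apply_symm_apply]
        exact hr
      · rw [dif_neg hrp] at hrw
        exact absurd hrw (by simp)
    · intro hw
      refine ⟨(e w : ℕ), hw, ?_⟩
      rw [dif_pos (e w).2]
      simp
  -- good reduction outside S
  have hS : ∀ w : HeightOneSpectrum (𝓞 ℚ), w ∉ S →
      W.HasGoodReductionAt w ∧ F.HasGoodReductionAt w ∧ (((3 : ℕ) : ℕ) : 𝓞 ℚ) ∉ w.asIdeal := by
    intro w hwS
    have hwL : (e w : ℕ) ∉ L := fun h ↦ hwS ((hmemS w).mpr h)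
    have hqp : (e w : ℕ).Prime := (e w).2
    refine ⟨?_, ?_, natCast_not_mem_of_primesEquiv_ne w Fact.out fun h ↦ hwL ?_⟩
    · rw [hWeq]; exact hasGoodReductionAt_mk_of_primesEquiv _ _ _ _ _ w rfl fun h ↦ hwL (hΔE _ hqp h)
    · rw [hFeq]; exact hasGoodReductionAt_mk_of_primesEquiv _ _ _ _ _ w rfl fun h ↦ hwL (hΔF _ hqp h)
    · show (primesEquiv w : ℕ) ∈ L
      rw [h]; decide
  -- the separating place `v₃`
  set v₃ : HeightOneSpectrum (𝓞 ℚ) := e.symm ⟨3, by norm_num⟩ with hv₃def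
  have hv₃ : (e v₃ : ℕ) = 3 := by rw [hv₃def, Equiv.apply_symm_apply]
  have hv₃S : v₃ ∈ S := (hmemS v₃).mpr (by rw [hv₃]; decide)
  -- the own point at `v₃`
  have hG₀ : ¬ ∃ Q : (W.baseChange (v₃.adicCompletion ℚ)).toAffine.Point,
      3 • Q = WeierstrassCurve.Affine.Point.baseChange (W' := W) ℚ (v₃.adicCompletion ℚ) (.some _ _ hG) := by
    subst hWeq
    exact not_exists_three_nsmul_eq_G₀ hv₃ hG
  -- the free places `2, 19, 43`: kind (i)
  have hplaces : ∀ w ∈ S, w ≠ v₃ →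
      ((((3 : ℕ) : ℕ) : 𝓞 ℚ) ∉ w.asIdeal ∧ Nat.card (nsmulAddMonoidHom 3 :
          (F.baseChange (w.adicCompletion ℚ)).toAffine.Point →+ _).ker = 1) ∨
      (W.HasSplitMultiplicativeReductionAt w ∧ F.HasSplitMultiplicativeReductionAt w ∧
        Nat.card (nsmulAddMonoidHom 3 :
          (W.baseChange (w.adicCompletion ℚ)).toAffine.Point →+ _).ker ≤ 3) ∨
      (W.HasMultiplicativeReductionAt w ∧ F.HasMultiplicativeReductionAt w ∧
        (∃ r : w.adicCompletion ℚ, algebraMap ℚ (w.adicCompletion ℚ) (-(W.c₄ / W.c₆)) =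
          r ^ 2 * algebraMap ℚ (w.adicCompletion ℚ) (-(F.c₄ / F.c₆))) ∧
        (∀ ζ : w.adicCompletion ℚ, ζ ^ 3 = 1 → ζ = 1)) := by
    intro w hwS hwv
    have hwL : (e w : ℕ) ∈ L := (hmemS w).mp hwS
    have hcases : (e w : ℕ) = 2 ∨ (e w : ℕ) = 3 ∨ (e w : ℕ) = 19 ∨ (e w : ℕ) = 43 := by
      simp only [hL, List.mem_cons, List.mem_nil_iff, or_false] at hwL
      omega
    rcases hcases with hw | hw | hw | hw
    · exact Or.inl ⟨natCast_not_mem_of_primesEquiv_ne w Fact.out (by rw [hw]; decide), h2 w hw⟩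
    · exfalso
      apply hwv
      apply e.injective
      rw [hv₃def, Equiv.apply_symm_apply]
      exact Subtype.ext hw
    · exact Or.inl ⟨natCast_not_mem_of_primesEquiv_ne w Fact.out (by rw [hw]; decide), h19 w hw⟩
    · exact Or.inl ⟨natCast_not_mem_of_primesEquiv_ne w Fact.out (by rw [hw]; decide), h43 w hw⟩
  exact VisibleTwoWitnessOwnPoint.missingLowerBoundAt_rankOne_irr_of_two_witnesses_of_ownPoint_of_places hGZK (by norm_num)
    hirr hr1 hq hv F θ hθ S hS (Affine.Point.some _ _ hT1) (Affine.Point.some _ _ hT2) hind v₃ hv₃S (h3a v₃ hv₃) (h3b v₃ hv₃)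
    (Affine.Point.some _ _ hG) hG₀ hplaces

/-- **Row `352944s1` Cassels–Tate-free AND θ-free**: the congruence `θ : F[3] ⥲ E[3]` CERTIFIED IN THE KERNEL by the DIRECT Hesse
pencil `X_E(3)` at `(l : m) = (-612 : 1)`, `u = 48` (Fisher 2012 Thm. 13.2, tree `VisCerts.torsionIso3_of_hesseCert_mk`, w3 g21's
certificate), then `missingLowerBound_352944s1_ctFree_of_congr`. REMAINING INPUTS: the named fact GZK (`hGZK`) and Cremona's data
`r_an(E) = 1` (`hr1`), `ord₃ #Ш(E)_an ≤ 2` (`hq`/`hv`; attested `9`) — NO Cassels–Tate, no congruence datum, no rank of `F`.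
Per pair; BSD₃(E) NOT claimed. [cite: Fisher2012Hessian, Thm. 13.2 (n = 3) and §8, §13] [cite: CremonaMazur2000, §3]
[cite: Cremona2006, Table 1 (Cremona labels 352944s1, 117648bh1)] -/
theorem missingLowerBound_352944s1_ctFree (hGZK : rank_eq_analyticRank_of_analyticRank_le_one)
    {W F : WeierstrassCurve ℚ} [W.IsElliptic] [W.IsGloballyMinimal] [F.IsElliptic] [F.IsGloballyMinimal]
    (hWeq : W = ⟨0, 0, 0, -7203, -235294⟩) (hFeq : F = ⟨0, 0, 0, -2307, 42050⟩)
    (hr1 : W.analyticRank = 1) {q : ℚ} (hq : shaAn W = (q : ℂ)) (hv : padicValRat 3 q ≤ 2) :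
    MissingLowerBoundAt W 3 := by
  obtain ⟨θ, hθ⟩ := VisCerts.torsionIso3_of_hesseCert_mk (W := W) (W' := F) hWeq hFeq
    345744 203294016 110736 (-36331200) (by norm_num) (by norm_num) (by norm_num) (by norm_num)
    (-612) 1 48 (by norm_num) (by norm_num) (by norm_num)
  exact missingLowerBound_352944s1_ctFree_of_congr hGZK hWeq hFeq hr1 hq hv θ hθ

end Summit.BirchSwinnertonDyer.BirchSwinnertonDyer.Theorems.Visible352944s1CTFree

end
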